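import Summits.BirchSwinnertonDyer.BirchSwinnertonDyer.Theorems.Rank2Observatory2DescKillSig2C
import HarnessLib

/-!
# BirchSwinnertonDyer — SEL2CUBIC kill layer: the certificate `sig2cCheck` in RESIDUE form

HONEST FRAMING: route `ShaPrimaryTransfer`, seat `bsd-line-spt-p1` (g30), `--supports` item T =
`FiniteShaComponentTransfer` (stmt-22356), UNCHANGED (conjecture-grade at corank ≥ 2). BSD in rank ≥ 2 is NOT
proved by any of this. THEOREMS ONLY.

As `…SelmerCubicKillCertMod`, for the `2`-adic TIER 2c signature certificate (a cubic place at `2`,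
`Rank2Observatory2DescKillSig2C*`): `root_rel₃_mod` (the cubic-place relation of `…Sig2CCore` under
`m ∣ Q₁, Q₂`) and `sig2cCheck_sound_mod` — the tree's `killValidAt_of_sig2cCheck` verbatim under the hypothesis
`2^N ∣ Q₁(v), Q₂(v)`, the statement a `2`-Selmer class contradicts.
[cite: Cassels1991LecturesEllipticCurves, §15] [cite: CremonaAlgorithms1997, §3.6]
-/

-- single-conjunct summit: `Summit.BirchSwinnertonDyer.BirchSwinnertonDyer.…` repeats the name by design
set_option linter.dupNamespace false

namespace Summit.BirchSwinnertonDyer.BirchSwinnertonDyer.Theorems.ShaPrimaryTransferSelmerCubicKill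

open Summit.BirchSwinnertonDyer.BirchSwinnertonDyer.Rank2Observatory
open Summit.BirchSwinnertonDyer.BirchSwinnertonDyer.Rank2Observatory.TwoDescKill

/-- **The kill relation at the cubic place, residue form**: as `root_rel₃`, assuming only `m ∣ Q₁`, `m ∣ Q₂`
for the same modulus `m`. [cite: Cassels1991LecturesEllipticCurves, §15] -/
theorem root_rel₃_mod {m m₁ m₀ a b c : ℤ} {ρ : ℤ × ℤ × ℤ} (hG₁ : m ∣ (cgev m₁ m₀ a b c ρ).1)
    (hG₂ : m ∣ (cgev m₁ m₀ a b c ρ).2.1) (hG₃ : m ∣ (cgev m₁ m₀ a b c ρ).2.2) {z : ℤ × ℤ × ℤ} {t₁ t₂ r₀ r₁ r₂ n : ℤ}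
    (h0₁ : m ∣ (zsq a b c z (r₀, r₁, r₂)).2.1 + t₁ * n ^ 2) (h0₂ : m ∣ (zsq a b c z (r₀, r₁, r₂)).2.2 + t₂ * n ^ 2) :
    m ∣ (cmul m₁ m₀ (cev m₁ m₀ ρ z) (cmul m₁ m₀ (cev m₁ m₀ ρ (r₀, r₁, r₂)) (cev m₁ m₀ ρ (r₀, r₁, r₂)))).1 -
        ((zsq a b c z (r₀, r₁, r₂)).1 - n ^ 2 * (cev m₁ m₀ ρ (0, t₁, t₂)).1) ∧
      m ∣ (cmul m₁ m₀ (cev m₁ m₀ ρ z) (cmul m₁ m₀ (cev m₁ m₀ ρ (r₀, r₁, r₂)) (cev m₁ m₀ ρ (r₀, r₁, r₂)))).2.1 -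
        (0 - n ^ 2 * (cev m₁ m₀ ρ (0, t₁, t₂)).2.1) ∧
      m ∣ (cmul m₁ m₀ (cev m₁ m₀ ρ z) (cmul m₁ m₀ (cev m₁ m₀ ρ (r₀, r₁, r₂)) (cev m₁ m₀ ρ (r₀, r₁, r₂)))).2.2 -
        (0 - n ^ 2 * (cev m₁ m₀ ρ (0, t₁, t₂)).2.2) := by
  obtain ⟨κ, hκ⟩ := cev_zsq m₁ m₀ a b c ρ z (r₀, r₁, r₂)
  obtain ⟨⟨k₁, hk₁⟩, ⟨k₂, hk₂⟩, ⟨k₃, hk₃⟩⟩ := dvd_cmul (m₁ := m₁) (m₀ := m₀) κ hG₁ hG₂ hG₃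
  obtain ⟨j₁, hq₁⟩ := h0₁
  obtain ⟨j₂, hq₂⟩ := h0₂
  have e₁ := congrArg Prod.fst hκ
  have e₂ := congrArg (fun x => x.2.1) hκ
  have e₃ := congrArg (fun x => x.2.2) hκ
  simp only [cev, cadd, csc] at e₁ e₂ e₃
  refine ⟨⟨-k₁ + ρ.1 * j₁ + (cmul m₁ m₀ ρ ρ).1 * j₂, ?_⟩, ⟨-k₂ + ρ.2.1 * j₁ + (cmul m₁ m₀ ρ ρ).2.1 * j₂, ?_⟩,
    ⟨-k₃ + ρ.2.2 * j₁ + (cmul m₁ m₀ ρ ρ).2.2 * j₂, ?_⟩⟩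
  · simp only [cev, cadd, csc]
    linear_combination (-1 : ℤ) * e₁ + ρ.1 * hq₁ + (cmul m₁ m₀ ρ ρ).1 * hq₂ - hk₁
  · simp only [cev, cadd, csc]
    linear_combination (-1 : ℤ) * e₂ + ρ.2.1 * hq₁ + (cmul m₁ m₀ ρ ρ).2.1 * hq₂ - hk₂
  · simp only [cev, cadd, csc]
    linear_combination (-1 : ℤ) * e₃ + ρ.2.2 * hq₁ + (cmul m₁ m₀ ρ ρ).2.2 * hq₂ - hk₃

/-- **Sig2C soundness, residue form**: if `sig2cCheck` succeeds, no integer vector primitive at `2` has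
`2^N ∣ Q₁` and `2^N ∣ Q₂` (the tree's proof verbatim with `root_rel₃_mod`).
[cite: CremonaAlgorithms1997, §3.6] [cite: Cassels1991LecturesEllipticCurves, §15] -/
theorem sig2cCheck_sound_mod {ram : Bool} {a b c : ℤ} {z : ℤ × ℤ × ℤ} {t₁ t₂ : ℤ} {N : ℕ} {ρ : ℤ × ℤ × ℤ}
    {jmax : ℕ} (h : sig2cCheck ram a b c z t₁ t₂ N ρ jmax = true) (v : ℤ × ℤ × ℤ × ℤ)
    (hprim : ¬ ((2 : ℤ) ∣ v.1 ∧ (2 : ℤ) ∣ v.2.1 ∧ (2 : ℤ) ∣ v.2.2.1 ∧ (2 : ℤ) ∣ v.2.2.2))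
    (h0 : (2 : ℤ) ^ N ∣ (killQ a b c z t₁ t₂ v).1 ∧ (2 : ℤ) ^ N ∣ (killQ a b c z t₁ t₂ v).2) : False := by
  obtain ⟨r₀, r₁, r₂, n⟩ := v
  simp only [sig2cCheck, Bool.and_eq_true, decide_eq_true_eq, beq_iff_eq] at h
  obtain ⟨⟨⟨⟨⟨⟨⟨⟨⟨⟨hG₁, hG₂⟩, hG₃⟩, hd⟩, hZ₁⟩, hZ₂⟩, hZ₃⟩, hZb⟩, hBN⟩, hpat⟩, hwalk⟩ := h
  -- names for the certified data
  have hZc := CME_cmod N (cev (tm₁ ram) (tm₀ ram) ρ z)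
  have hTc := CME_cmod N (cev (tm₁ ram) (tm₀ ram) ρ (0, t₁, t₂))
  generalize hZdef : cmod N (cev (tm₁ ram) (tm₀ ram) ρ z) = Z at hZ₁ hZ₂ hZ₃ hZb hBN hpat hwalk hZc
  generalize hTdef : cmod N (cev (tm₁ ram) (tm₀ ram) ρ (0, t₁, t₂)) = T at hpat hwalk hTc
  have hΔ := splitPow_spec 2 N (det3 (tm₁ ram) (tm₀ ram) ρ)
  generalize hdd : splitPow 2 N (det3 (tm₁ ram) (tm₀ ram) ρ) = dd at hd hBN hpat hwalk hΔ
  obtain ⟨δ, d⟩ := dd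
  generalize hcZ : c3min N Z = cZ at hZ₁ hZ₂ hZ₃ hZb hBN hpat hwalk
  simp only [Nat.cast_ofNat] at hΔ
  simp only at hd hBN hpat hwalk
  set B := cB ram cZ δ with hB
  -- `Z = 2^cZ · Z̄`, `Z·T = 2^cZ · (Z̄·T)`
  set Zb : ℤ × ℤ × ℤ := (Z.1 / (2 : ℤ) ^ cZ, Z.2.1 / (2 : ℤ) ^ cZ, Z.2.2 / (2 : ℤ) ^ cZ) with hZbdef
  have hZe : Z = csc ((2 : ℤ) ^ cZ) Zb := by
    simp only [csc, hZbdef]; ext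
    · exact (Int.mul_ediv_cancel' (Int.dvd_of_emod_eq_zero hZ₁)).symm
    · exact (Int.mul_ediv_cancel' (Int.dvd_of_emod_eq_zero hZ₂)).symm
    · exact (Int.mul_ediv_cancel' (Int.dvd_of_emod_eq_zero hZ₃)).symm
  have hZTe : cmul (tm₁ ram) (tm₀ ram) Z T = csc ((2 : ℤ) ^ cZ) (cmul (tm₁ ram) (tm₀ ram) Zb T) := by
    rw [hZe, cmul_comm, cmul_csc, cmul_comm]
  have hdodd : ¬ (2 : ℤ) ∣ d := fun h2 => hd (Int.emod_eq_zero_of_dvd h2)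
  -- the kill relation `E : Q² ≡ w₀·Z − n²·(Z·T) (mod 2^N)`, `Q = Z·R`
  set R := cev (tm₁ ram) (tm₀ ram) ρ (r₀, r₁, r₂) with hR
  set w₀ := (zsq a b c z (r₀, r₁, r₂)).1 with hw₀
  obtain ⟨d₁, d₂, d₃⟩ := root_rel₃_mod (m₁ := tm₁ ram) (m₀ := tm₀ ram) (Int.dvd_of_emod_eq_zero hG₁)
    (Int.dvd_of_emod_eq_zero hG₂) (Int.dvd_of_emod_eq_zero hG₃) (by simpa only [killQ] using h0.1)
    (by simpa only [killQ] using h0.2)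
  rw [zero_sub] at d₂ d₃
  have E0 : CME ((2 : ℤ) ^ N) (cmul (tm₁ ram) (tm₀ ram) Z (cmul (tm₁ ram) (tm₀ ram) R R))
      (w₀ - n ^ 2 * T.1, -(n ^ 2 * T.2.1), -(n ^ 2 * T.2.2)) := by
    refine (hZc.cmul CME.rfl).trans ⟨?_, ?_, ?_⟩
    · exact (Int.modEq_iff_dvd.mpr d₁).symm.trans ((Int.ModEq.refl w₀).sub ((hTc.1.symm).mul_left _))
    · exact (Int.modEq_iff_dvd.mpr d₂).symm.trans ((hTc.2.1.symm).mul_left _).neg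
    · exact (Int.modEq_iff_dvd.mpr d₃).symm.trans ((hTc.2.2.symm).mul_left _).neg
  have E : CME ((2 : ℤ) ^ N) (cmul (tm₁ ram) (tm₀ ram) (cmul (tm₁ ram) (tm₀ ram) Z R) (cmul (tm₁ ram) (tm₀ ram) Z R))
      (cPat Z (cmul (tm₁ ram) (tm₀ ram) Z T) w₀ (-(n ^ 2))) := by
    have := (CME.rfl (A := Z)).cmul E0 (m₁ := tm₁ ram) (m₀ := tm₀ ram)
    rwa [← cmul_sq_ZR, cmul_lin'] at this
  by_cases hn : (2 : ℤ) ∣ n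
  · -- `n` even: the content bound is available
    have hRn : ¬ ((2 : ℤ) ^ (δ + 1) ∣ R.1 ∧ (2 : ℤ) ^ (δ + 1) ∣ R.2.1 ∧ (2 : ℤ) ^ (δ + 1) ∣ R.2.2) := by
      intro hh
      obtain ⟨e₀, e₁, e₂⟩ := even_of_cev_dvd hΔ hdodd hh.1 hh.2.1 hh.2.2
      exact hprim ⟨e₀, e₁, e₂, hn⟩
    have hcont := content_ZRR ram hZe hZb hRn
    have hBW : ∀ m : ℕ, (2 : ℤ) ^ m ∣ w₀ → (2 : ℤ) ^ m ∣ n ^ 2 → m ≤ B := by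
      intro m hw hn2
      by_contra hm
      have p : (2 : ℤ) ^ (B + 1) ∣ (2 : ℤ) ^ m := pow_dvd_pow 2 (by omega)
      refine hcont (dvd_of_CME (E0.of_dvd (pow_dvd_pow 2 hBN)) ⟨?_, ?_, ?_⟩)
      · exact dvd_sub (p.trans hw) ((p.trans hn2).mul_right _)
      · exact dvd_neg.mpr ((p.trans hn2).mul_right _)
      · exact dvd_neg.mpr ((p.trans hn2).mul_right _)
    by_cases hn0 : n = 0
    · subst hn0
      by_cases hw : w₀ = 0
      · have := hBW (B + 1) (by rw [hw]; exact dvd_zero _) (by simp)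
        omega
      · obtain ⟨k, u, hk, hu⟩ := exists_two_pow_mul_odd w₀.natAbs w₀ hw le_rfl
        have hkB : k ≤ B := hBW k (by rw [hk]; exact dvd_mul_right _ _) (by simp)
        exact pat_contra ram hpat hkB hu (sh := 0) (zero_mem_patShifts k) hZe hZTe E (by rw [hk, sub_self]; exact dvd_zero _)
          (by simp)
    · obtain ⟨τ, n₁, hτ, hn₁⟩ := exists_two_pow_mul_odd n.natAbs n hn0 le_rfl
      have hn2 : n ^ 2 = (2 : ℤ) ^ (2 * τ) * n₁ ^ 2 := by rw [hτ]; ring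
      by_cases hw : w₀ = 0
      · -- integral side with `w₁ = 0`
        have hτB : 2 * τ ≤ B := hBW (2 * τ) (by rw [hw]; exact dvd_zero _) (by rw [hn2]; exact dvd_mul_right _ _)
        refine walk_contra ram (Q := cmul (tm₁ ram) (tm₀ ram) Z R) hZe hZTe hwalk (τ := τ) (by omega) (by omega) hn₁ (w₁ := 0) ?_
        rw [mul_zero, ← hw, ← hn2]; exact E
      · obtain ⟨k, u, hk, hu⟩ := exists_two_pow_mul_odd w₀.natAbs w₀ hw le_rfl
        by_cases hkτ : 2 * τ ≤ k
        · -- integral side with `w₁ = 2^(k − 2τ)·u`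
          have hτB : 2 * τ ≤ B :=
            hBW (2 * τ) (by rw [hk]; exact (pow_dvd_pow 2 hkτ).mul_right u) (by rw [hn2]; exact dvd_mul_right _ _)
          refine walk_contra ram (Q := cmul (tm₁ ram) (tm₀ ram) Z R) hZe hZTe hwalk (τ := τ) (by omega) (by omega) hn₁ (w₁ := (2 : ℤ) ^ (k - 2 * τ) * u) ?_
          have e : w₀ = (2 : ℤ) ^ (2 * τ) * ((2 : ℤ) ^ (k - 2 * τ) * u) := by
            rw [hk, ← mul_assoc, ← pow_add, Nat.add_sub_cancel' hkτ]
          rw [← e, ← hn2]; exact E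
        · -- pattern side: `σ = 2τ − k ≥ 1`
          have hkB : k ≤ B := hBW k (by rw [hk]; exact dvd_mul_right _ _)
            (by rw [hn2]; exact (pow_dvd_pow 2 (by omega : k ≤ 2 * τ)).mul_right _)
          obtain ⟨σ, hσ⟩ : ∃ σ : ℕ, 2 * τ = k + σ := ⟨2 * τ - k, by omega⟩
          by_cases hσ4 : 4 ≤ σ
          · refine pat_contra ram hpat hkB hu (sh := 0) (zero_mem_patShifts k) hZe hZTe E
              (by rw [hk, sub_self]; exact dvd_zero _) ?_
            rw [hn2, hσ, mul_zero, add_zero]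
            exact dvd_neg.mpr ((pow_dvd_pow 2 (by omega : k + 4 ≤ k + σ)).mul_right _)
          · obtain ⟨σ', hσ'⟩ : ∃ σ' : ℕ, σ = σ' + 1 := ⟨σ - 1, by omega⟩
            refine pat_contra ram hpat hkB hu (sh := (2 : ℤ) ^ σ) ?_ hZe hZTe E
              (by rw [hk, sub_self]; exact dvd_zero _) ?_
            · have : σ = 1 ∨ σ = 2 ∨ σ = 3 := by omega
              rcases this with rfl | rfl | rfl
              · rw [patShifts, if_neg (by omega)]; simp
              · rw [patShifts, if_pos (by omega)]; simp
              · rw [patShifts, if_neg (by omega)]; simp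
            · obtain ⟨j, hj⟩ := eight_dvd_sq_sub_one hn₁
              refine ⟨-((2 : ℤ) ^ σ' * j), ?_⟩
              rw [hn2, hσ, hσ']
              have e : n₁ ^ 2 = 8 * j + 1 := by linarith
              rw [e, pow_add, pow_add, pow_succ]; ring
  · -- `n` odd: integral side with `τ = 0`
    refine walk_contra ram (Q := cmul (tm₁ ram) (tm₀ ram) Z R) hZe hZTe hwalk (τ := 0) (Nat.zero_le _) (by omega) hn (w₁ := w₀) ?_
    simpa using E

end Summit.BirchSwinnertonDyer.BirchSwinnertonDyer.Theorems.ShaPrimaryTransferSelmerCubicKill
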